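import Mathlib
import Literature.Computability.AlgebraicComplexity.GroupTheoreticMatMul
import Literature.Barriers.MatrixMultiplication.TricoloredSumFreeBarrier
import Summits.MatrixMultiplication.MatrixMultiplication.Theorems.AbelianSTPPSieveVP
import Summits.MatrixMultiplication.MatrixMultiplication.Theorems.AbelianSTPPCensusVPBookkeeping

/-!
# The STPP fibre lemma and rule U11-G modulo Grynkiewicz's theorem

Support file for the abelian STPP census of cell mm-stpp (rung F-M1; candidate route `AbelianSTPPCensusVP`,
leaf T_E/337; HOME/mm-stpp-lit/POLLARD-KILLS.md v1.2 §2, REF [52]).  Notation as in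
`AbelianSTPPCensusVPBookkeeping`: STPP family `(A i, B i, C i)_{i<N}` with non-empty sets in a finite abelian
group `H`, `X = ⋃ (B j − A j)`, `Y = ⋃ (C k − B k)`, `r = r_{X,Y}`, shapes `aᵢ, bᵢ, cᵢ`.

* `fibre_le` (**the fibre lemma**): if `X′ ⊆ X`, `Y′ ⊆ Y` and every sum `x′ + y′` (`x′ ∈ X′`, `y′ ∈ Y′`) has at
  least `t` representations in `X + Y`, then `|X ∖ X′| + |Y ∖ Y′| ≥ L_B(t) = Σ_{bᵢ<t} bᵢ·min(aᵢ,cᵢ)`: for each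
  `b ∈ B i` with `bᵢ < t` the whole fibre `b − A i ⊆ X` misses `X′` or the whole fibre `C i − b ⊆ Y` misses `Y′`
  (else `r(c′ − a) ≥ t > bᵢ = r(c′ − a)` by (B2)), and the fibres over distinct `(i, b)` are disjoint by (B1).
* `u11GFormB_of_grynkiewiczWeak`, `u11GSound_of_grynkiewiczWeak`: **rule U11-G follows from the weak form of
  Grynkiewicz's `t`-fold Pollard theorem** ([Gry10] Thm 1.1 (6)–(8), Thm 1.2 (10)–(12)) — stated here as the
  HYPOTHESIS `GrynkiewiczWeak` of the candidate route, verbatim — via the fibre lemma (the structural alternative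
  needs `|X ∖ X′| + |Y ∖ Y′| ≤ t − 1 < t ≤ L_B(t)`) and (B3) (`N_t ≤ UB_B(t)`); forms A, C by `IsSTPP.rotate`.
  The conclusion is VERBATIM the crux `U11GSound`; the theorem is CONDITIONAL on `GrynkiewiczWeak` (not in the tree).

WHAT THIS IS NOT: no proof of Grynkiewicz's theorem, no `ω` statement, no census verdict.

## References
* D. J. Grynkiewicz, *On extending Pollard's theorem for t-representable sums*, Israel J. Math. 177 (2010)
  413–439 (arXiv:0803.2601), Thm 1.1, Thm 1.2.
* H. Cohn, R. Kleinberg, B. Szegedy, C. Umans, FOCS 2005, Def. 5.1.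
-/

-- single-conjunct summit: the mandated namespace repeats `MatrixMultiplication`.
set_option linter.dupNamespace false

namespace Summit.MatrixMultiplication.MatrixMultiplication.Theorems

namespace STPPRepCount

open Finset Literature.Computability.AlgebraicComplexity
open scoped Pointwise

variable {H : Type*} [AddCommGroup H] [DecidableEq H] {N : ℕ} {A B C : Fin N → Finset H}

/-! ### Fibres -/

/-- The `X`-fibre over `(i, b)`: `{b − a : a ∈ A i} ⊆ B i − A i ⊆ X`. [original] -/
theorem image_sub_subset_diffUnion_AB {i : Fin N} {b : H} (hb : b ∈ B i) :
    (A i).image (fun a => b - a) ⊆ diffUnion A B := by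
  intro x hx
  obtain ⟨a, ha, rfl⟩ := mem_image.1 hx
  exact mem_biUnion.2 ⟨i, mem_univ _, sub_mem_sub hb ha⟩

/-- The `Y`-fibre over `(i, b)`: `{c − b : c ∈ C i} ⊆ C i − B i ⊆ Y`. [original] -/
theorem image_sub_subset_diffUnion_BC {i : Fin N} {b : H} (hb : b ∈ B i) :
    (C i).image (fun c => c - b) ⊆ diffUnion B C := by
  intro y hy
  obtain ⟨c, hc, rfl⟩ := mem_image.1 hy
  exact mem_biUnion.2 ⟨i, mem_univ _, sub_mem_sub hc hb⟩

omit [DecidableEq H] in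
/-- For `b ∈ B i` with `bᵢ < t`: if some `b − a` (`a ∈ A i`) lies in `X′` and some `c − b` (`c ∈ C i`) lies in `Y′`,
where every `x′ + y′` is `t`-popular, then `t ≤ r(c − a) = bᵢ` — contradiction. [original] -/
theorem fibre_alternative [DecidableEq H] (h : IsSTPP A B C) {X' Y' : Finset H} {t : ℕ}
    (hpop : ∀ x ∈ X', ∀ y ∈ Y', t ≤ repCount (diffUnion A B) (diffUnion B C) (x + y))
    {i : Fin N} (hi : (B i).card < t) {b : H} (hb : b ∈ B i) :
    (∀ a ∈ A i, b - a ∉ X') ∨ (∀ c ∈ C i, c - b ∉ Y') := by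
  by_contra hcon
  rw [not_or, not_forall, not_forall] at hcon
  obtain ⟨⟨a, ha⟩, ⟨c, hc⟩⟩ := hcon
  rw [Classical.not_imp, not_not] at ha hc
  have key := hpop _ ha.2 _ hc.2
  rw [show b - a + (c - b) = c - a by abel, repCount_eq h ha.1 hc.1] at key
  exact absurd hb (fun _ => Nat.lt_irrefl _ (lt_of_lt_of_le hi key))

/-- **The fibre lemma.** If `X′ ⊆ X`, `Y′ ⊆ Y` and every `x′ + y′` (`x′ ∈ X′`, `y′ ∈ Y′`) has at least `t`
representations in `X + Y`, then `L_B(t) = Σ_{bᵢ<t} bᵢ·min(aᵢ,cᵢ) ≤ |X ∖ X′| + |Y ∖ Y′|`. [original] -/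
theorem lB_le_card_sdiff_add (h : IsSTPP A B C) (hA : ∀ i, (A i).Nonempty) (hC : ∀ i, (C i).Nonempty)
    {X' Y' : Finset H} {t : ℕ}
    (hpop : ∀ x ∈ X', ∀ y ∈ Y', t ≤ repCount (diffUnion A B) (diffUnion B C) (x + y)) :
    lB (fun i => (A i).card) (fun i => (B i).card) (fun i => (C i).card) t ≤
      (diffUnion A B \ X').card + (diffUnion B C \ Y').card := by
  -- the index set of fibres: pairs `(i, b)`, `b ∈ B i`, `bᵢ < t`
  set P : Finset (Σ _ : Fin N, H) := (univ.filter fun i => (B i).card < t).sigma B with hP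
  set FX : (Σ _ : Fin N, H) → Finset H := fun p => ((A p.1).image fun a => p.2 - a) \ X' with hFX
  set FY : (Σ _ : Fin N, H) → Finset H := fun p => ((C p.1).image fun c => c - p.2) \ Y' with hFY
  -- Step 1: `L_B(t) = Σ_{p ∈ P} min(a,c)` and each summand is at most `|FX p| + |FY p|`
  have hL : lB (fun i => (A i).card) (fun i => (B i).card) (fun i => (C i).card) t =
      ∑ p ∈ P, min (A p.1).card (C p.1).card := by
    unfold lB
    rw [hP, sum_sigma, ← sum_filter]
    refine sum_congr rfl fun i _ => ?_
    dsimp only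
    rw [sum_const, smul_eq_mul]
  have hstep : ∀ p ∈ P, min (A p.1).card (C p.1).card ≤ (FX p).card + (FY p).card := by
    rintro ⟨i, b⟩ hp
    rw [hP, mem_sigma, mem_filter] at hp
    rcases fibre_alternative h hpop hp.1.2 hp.2 with hX | hY
    · have : FX ⟨i, b⟩ = (A i).image fun a => b - a := by
        rw [hFX]
        exact sdiff_eq_self_of_disjoint (disjoint_left.2 fun x hx hxX => by
          obtain ⟨a, ha, rfl⟩ := mem_image.1 hx; exact hX a ha hxX)
      rw [this, card_image_of_injective _ (fun a a' (haa : b - a = b - a') => sub_right_inj.mp haa)]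
      exact (min_le_left _ _).trans (Nat.le_add_right _ _)
    · have : FY ⟨i, b⟩ = (C i).image fun c => c - b := by
        rw [hFY]
        exact sdiff_eq_self_of_disjoint (disjoint_left.2 fun y hy hyY => by
          obtain ⟨c, hc, rfl⟩ := mem_image.1 hy; exact hY c hc hyY)
      rw [this, card_image_of_injective _ (fun c c' (hcc : c - b = c' - b) => sub_left_inj.mp hcc)]
      exact (min_le_right _ _).trans (Nat.le_add_left _ _)
  -- Step 2: the fibres are pairwise disjoint and sit inside `X ∖ X′`, `Y ∖ Y′`
  have hdX : (P : Set (Σ _ : Fin N, H)).PairwiseDisjoint FX := by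
    rintro ⟨i, b⟩ hp ⟨i', b'⟩ hp' hne
    rw [Function.onFun, hFX, disjoint_left]
    intro x hx hx'
    simp only [mem_sdiff, mem_image] at hx hx'
    obtain ⟨⟨a, ha, rfl⟩, -⟩ := hx
    obtain ⟨⟨a', ha', he⟩, -⟩ := hx'
    simp only [mem_coe, hP, mem_sigma] at hp hp'
    obtain ⟨h1, -, h3⟩ := sub_BA_inj h (hC i) ha hp.2 ha' hp'.2 he.symm
    subst h1; subst h3
    exact hne rfl
  have hdY : (P : Set (Σ _ : Fin N, H)).PairwiseDisjoint FY := by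
    rintro ⟨i, b⟩ hp ⟨i', b'⟩ hp' hne
    rw [Function.onFun, hFY, disjoint_left]
    intro y hy hy'
    simp only [mem_sdiff, mem_image] at hy hy'
    obtain ⟨⟨c, hc, rfl⟩, -⟩ := hy
    obtain ⟨⟨c', hc', he⟩, -⟩ := hy'
    simp only [mem_coe, hP, mem_sigma] at hp hp'
    obtain ⟨h1, h2, -⟩ := sub_CB_inj h (hA i) hp.2 hc hp'.2 hc' he.symm
    subst h1; subst h2
    exact hne rfl
  have hsubX : P.biUnion FX ⊆ diffUnion A B \ X' := by
    intro x hx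
    obtain ⟨⟨i, b⟩, hp, hx⟩ := mem_biUnion.1 hx
    rw [hP, mem_sigma] at hp
    rw [hFX, mem_sdiff] at hx
    exact mem_sdiff.2 ⟨image_sub_subset_diffUnion_AB hp.2 hx.1, hx.2⟩
  have hsubY : P.biUnion FY ⊆ diffUnion B C \ Y' := by
    intro y hy
    obtain ⟨⟨i, b⟩, hp, hy⟩ := mem_biUnion.1 hy
    rw [hP, mem_sigma] at hp
    rw [hFY, mem_sdiff] at hy
    exact mem_sdiff.2 ⟨image_sub_subset_diffUnion_BC hp.2 hy.1, hy.2⟩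
  -- Step 3: sum up
  calc lB (fun i => (A i).card) (fun i => (B i).card) (fun i => (C i).card) t
      = ∑ p ∈ P, min (A p.1).card (C p.1).card := hL
    _ ≤ ∑ p ∈ P, ((FX p).card + (FY p).card) := sum_le_sum hstep
    _ = (P.biUnion FX).card + (P.biUnion FY).card := by
        rw [sum_add_distrib, card_biUnion hdX, card_biUnion hdY]
    _ ≤ (diffUnion A B \ X').card + (diffUnion B C \ Y').card :=
        Nat.add_le_add (card_le_card hsubX) (card_le_card hsubY)

/-! ### Rule U11-G from the weak form of Grynkiewicz's theorem -/

/-- **Rule U11-G, form B, modulo Grynkiewicz.**  Assume the weak form of [Gry10] Thm 1.1/1.2 (the hypothesis,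
verbatim the support item `GrynkiewiczWeak` of the candidate route).  Then an STPP family with non-empty sets in a
finite abelian group `H` satisfies `U11GFormB |H|` at its shape list: for `2 ≤ t ≤ min(P_AB, P_BC)` with
`t ≤ L_B(t)`, the structural alternative is excluded by the fibre lemma (`t ≤ L_B(t) ≤ |X∖X′|+|Y∖Y′| ≤ t−1`), and
the Pollard-type floor combines with (B3). [original] -/
theorem u11GFormB_of_grynkiewiczWeak {H : Type} [AddCommGroup H] [Fintype H] [DecidableEq H]
    {N : ℕ} {A B C : Fin N → Finset H}
    (hG : ∀ (G : Type) [AddCommGroup G] [Fintype G] [DecidableEq G] (X Y : Finset G) (t : ℕ), 2 ≤ t →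
      t ≤ X.card → t ≤ Y.card →
      (((3 ≤ t → t * (X.card + Y.card) + 1 ≤ Nt X Y t + 2 * t ^ 2) ∧
        (t = 2 → 2 * (X.card + Y.card) ≤ Nt X Y 2 + 4)) ∨
      ∃ X' ⊆ X, ∃ Y' ⊆ Y, (X \ X').card + (Y \ Y').card + 1 ≤ t ∧
        ∀ x ∈ X', ∀ y ∈ Y', t ≤ repCount X Y (x + y)))
    (h : IsSTPP A B C) (hA : ∀ i, (A i).Nonempty) (hB : ∀ i, (B i).Nonempty) (hC : ∀ i, (C i).Nonempty) :
    U11GFormB (Fintype.card H) (fun i => (A i).card) (fun i => (B i).card) (fun i => (C i).card) := by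
  intro t ht2 htX htY htL
  have hXc : (diffUnion A B).card = pAB (fun i => (A i).card) (fun i => (B i).card) (fun i => (C i).card) :=
    card_diffUnion_AB h hC
  have hYc : (diffUnion B C).card = pBC (fun i => (A i).card) (fun i => (B i).card) (fun i => (C i).card) :=
    card_diffUnion_BC h hA
  rcases hG H (diffUnion A B) (diffUnion B C) t ht2 (hXc ▸ htX) (hYc ▸ htY) with
    ⟨h3, h2⟩ | ⟨X', -, Y', -, hl, hpop⟩
  · rw [hXc, hYc] at h3 h2
    refine ⟨fun ht => ?_, fun ht => ?_⟩
    · subst ht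
      exact (h2 rfl).trans (Nat.add_le_add_right (Nt_le_ubB h hB 2) 4)
    · exact (h3 ht).trans (Nat.add_le_add_right (Nt_le_ubB h hB t) _)
  · exfalso
    have hf := lB_le_card_sdiff_add h hA hC hpop
    omega

/-- **`U11GSound` modulo `GrynkiewiczWeak`** — hypothesis and conclusion VERBATIM the items `GrynkiewiczWeak`
(support) and `U11GSound` (crux 2) of the candidate route `AbelianSTPPCensusVP`: rule U11-G in all three letter
forms for every STPP family with non-empty sets in a finite abelian group (forms A, C = form B for the rotated
families `(C,A,B)`, `(B,C,A)`, `IsSTPP.rotate`).  CONDITIONAL: [Gry10] Thm 1.1/1.2 is not in the tree. [original] -/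
theorem u11GSound_of_grynkiewiczWeak
    (hG : ∀ (G : Type) [AddCommGroup G] [Fintype G] [DecidableEq G] (X Y : Finset G) (t : ℕ), 2 ≤ t →
      t ≤ X.card → t ≤ Y.card →
      (((3 ≤ t → t * (X.card + Y.card) + 1 ≤ Nt X Y t + 2 * t ^ 2) ∧
        (t = 2 → 2 * (X.card + Y.card) ≤ Nt X Y 2 + 4)) ∨
      ∃ X' ⊆ X, ∃ Y' ⊆ Y, (X \ X').card + (Y \ Y').card + 1 ≤ t ∧
        ∀ x ∈ X', ∀ y ∈ Y', t ≤ repCount X Y (x + y))) :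
    ∀ (H : Type) [AddCommGroup H] [Fintype H] (N : ℕ) (A B C : Fin N → Finset H), IsSTPP A B C →
      (∀ i, (A i).Nonempty ∧ (B i).Nonempty ∧ (C i).Nonempty) →
        U11G (Fintype.card H) (fun i => (A i).card) (fun i => (B i).card) (fun i => (C i).card) := by
  intro H _ _ N A B C h hne
  classical
  have hA := fun i => (hne i).1
  have hB := fun i => (hne i).2.1
  have hC := fun i => (hne i).2.2
  exact ⟨u11GFormB_of_grynkiewiczWeak hG h hA hB hC,
    u11GFormB_of_grynkiewiczWeak hG h.rotate.rotate hC hA hB,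
    u11GFormB_of_grynkiewiczWeak hG h.rotate hB hC hA⟩

end STPPRepCount

end Summit.MatrixMultiplication.MatrixMultiplication.Theorems
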